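import Mathlib
import Literature.Barriers.ValiantsHypothesis.AlgebraicNaturalProofs
import Literature.Barriers.ValiantsHypothesis.GKSS17NaturalProofsPIT
import Literature.Barriers.ValiantsHypothesis.GKSS17FSVPresentation
import Summits.ValiantsHypothesis.ValiantsHypothesis.Theorems.BarrierLeverDefinableEquationsDefs
import HarnessLib

/-!
# Crux `BarrierLever.DefinableEquations` (stmt-8745) ⟺ `SingleSizeEquations` (stmt-8749) —
# the strength door, part 2: the class of bounded BALANCED STRENGTH is THIN

Sibling of `BarrierLeverDefinableEquationsBalancedStrength.lean` (seat val-np-p5 gen 21), which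
proves `SmallCircuits ℂ n b ⊆ BP(n, 4n^b(n+1)²+1)` (every homogeneous component `hom_d f` is a sum
of `≤ 4n^b(d+1)²+1` products `g·h`, `deg g, deg h ≤ ⌊(2d+2)/3⌋`) and the door "explicit equations
for `BP` ⇒ the crux at `b`".  Here: the door is not vacuous.

* §5 `exists_equation_of_count` — if `2s · C(n + ⌊(2n+2)/3⌋, n) < C(2n−1, n)` then a NONZERO
  polynomial in the `N = C(2n,n)` coefficient variables vanishes on `BP(n, s)`.  The top
  component `hom_n f = Σ_{i<s} g_i h_i` is the image of the `2s·C(n+⌊(2n+2)/3⌋, n)` coefficients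
  of the factors under one fixed quadratic map (`coeff_sum_mul_eq_eval`); more coordinates
  (`#topMonomials n = C(2n−1,n)`) than parameters forces an algebraic dependence
  (`exists_aeval_eq_zero_of_card_lt`, from Mathlib's transcendence degree of a polynomial ring:
  `MvPolynomial.trdeg_of_isDomain`, `AlgebraicIndependent.cardinalMk_le_trdeg`), transported to
  the `N` coefficient variables along `topIncl`.
* §6 `count_eventually` (`2 n^c · C(n+⌊(2n+2)/3⌋, n) < C(2n−1, n)` eventually in `n`; the ratio is
  `≥ 2^{n−1−⌊(2n+2)/3⌋}` by Pascal steps below the middle, against `poly(n)`),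
  `exists_equation_eventually` (nonzero equations of `BP(n, s)`, all `s ≤ n^c`, eventually),
  and — in the sibling file, `BalancedStrength.exists_equation_smallCircuits` — hence nonzero
  equations of `SmallCircuits ℂ n b` exist eventually for every `b` (a circuit-free re-proof,
  without the annihilator machinery behind the tree's `CT23_lemma_4_7_holds`; their EXPLICITNESS
  is exactly the open crux).  This file imports no route file (only Literature and the crux's
  `…Defs`), so it is route-independent.

Honest framing: existence of equations by a dimension count (Heintz–Schnorr style), nothing
explicit; 8745/8749 stay OPEN at `b = 2` (Chatterjee–Tengse 2023 §1.3, dir. 2); nothing on crux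
14610 or on `VP ≠ VNP`, which is NOT proved.

References: as in the sibling file; J. Heintz, C.-P. Schnorr, *Testing polynomials which are easy
to compute*, STOC 1980 (dimension/degree counts for the variety of easy polynomials); Forbes–
Shpilka–Volk 2018, Def. 1 (the frame); Grochow–Kumar–Saks–Saraf 2017 §2.1 (`#` of degree-`d`
monomials, tree `GKSS2017.ncard_homMonomials`).
-/

set_option linter.dupNamespace false

noncomputable section

namespace Summit.ValiantsHypothesis.ValiantsHypothesis.Theorems.BarrierLeverDefinableEquations

open MvPolynomial
open Literature.Computability.AlgebraicComplexity Literature.Barriers.ValiantsHypothesis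
open scoped BigOperators

namespace BalancedStrength

/-! ## §5 The balanced-product class is thin: non-explicit equations exist -/

section Thin

open Cardinal in
/-- Counting: a family of more polynomials than there are variables is algebraically dependent
(transcendence degree of a polynomial ring; Mathlib `MvPolynomial.trdeg_of_isDomain`).
[folklore] -/
theorem exists_aeval_eq_zero_of_card_lt {ι τ : Type} [Finite ι] [Finite τ]
    (hcard : Nat.card τ < Nat.card ι) (Φ : ι → MvPolynomial τ ℂ) :
    ∃ P : MvPolynomial ι ℂ, P ≠ 0 ∧ aeval Φ P = 0 := by
  by_contra hcon
  push Not at hcon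
  have hind : AlgebraicIndependent ℂ Φ :=
    algebraicIndependent_iff.2 fun p hp => by
      by_contra hne
      exact hcon p hne hp
  have h1 := hind.cardinalMk_le_trdeg
  rw [MvPolynomial.trdeg_of_isDomain, Cardinal.lift_id] at h1
  have h2 := Cardinal.toNat_le_toNat h1 (Cardinal.lt_aleph0_of_finite τ)
  change Nat.card ι ≤ Nat.card τ at h2
  omega

/-- `coeff_μ f = 0` once `|μ| > deg f`. [folklore] -/
theorem coeff_eq_zero_of_degree_lt {σ : Type*} {f : MvPolynomial σ ℂ} {μ : σ →₀ ℕ}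
    (h : f.totalDegree < μ.degree) : coeff μ f = 0 :=
  coeff_eq_zero_of_totalDegree_lt (by rwa [Finsupp.degree_apply] at h)

/-- The monomials of degree `≤ A` in `n` variables form a finite type. [folklore] -/
theorem finite_degLE (n A : ℕ) : Finite {m : Fin n →₀ ℕ // m.degree ≤ A} := by
  apply Nat.finite_of_card_ne_zero
  rw [GKSS2017.ncard_degLE]
  exact (Nat.choose_pos (by omega)).ne'

/-- `#(topMonomials n) = C(2n - 1, n)` (monomials of degree exactly `n` in `n` variables).
[cite: GrochowKumarSaksSaraf2017, §2.1] -/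
theorem natCard_topMonomials (n : ℕ) : Nat.card (topMonomials n) = (2 * n - 1).choose n := by
  rw [show topMonomials n = GKSS2017.homMonomials n n from rfl, GKSS2017.ncard_homMonomials]
  congr 1
  omega

/-- The top monomials form a finite type. [folklore] -/
theorem finite_topMonomials (n : ℕ) : Finite (topMonomials n) :=
  ((GKSS2017.degLEMonomials_finite n).subset (topMonomials_subset n)).to_subtype

/-- **The coefficient map of `Σ_i g_i h_i` is a polynomial map.** With parameters the
coefficients of the `g_i, h_i` (monomials of degree `≤ A`), the `μ`-th coefficient of
`Σ_{i<s} g_i h_i` is the value of the fixed quadratic polynomial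
`Φ_μ = Σ_i Σ_{α+β=μ, |α|,|β| ≤ A} X_{i,α} Y_{i,β}`. [folklore] -/
theorem coeff_sum_mul_eq_eval {n s A : ℕ} (g h : Fin s → MvPolynomial (Fin n) ℂ)
    (hg : ∀ i, (g i).totalDegree ≤ A) (hh : ∀ i, (h i).totalDegree ≤ A) (μ : Fin n →₀ ℕ) :
    coeff μ (∑ i, g i * h i) =
      eval (fun v : Fin s × Bool × {m : Fin n →₀ ℕ // m.degree ≤ A} =>
          if v.2.1 then coeff v.2.2.1 (g v.1) else coeff v.2.2.1 (h v.1))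
        (∑ i : Fin s, ∑ p ∈ Finset.HasAntidiagonal.antidiagonal μ,
          if hp : p.1.degree ≤ A ∧ p.2.degree ≤ A then
            X (i, true, ⟨p.1, hp.1⟩) * X (i, false, ⟨p.2, hp.2⟩) else 0) := by
  classical
  rw [coeff_sum, map_sum]
  refine Finset.sum_congr rfl fun i _ => ?_
  rw [coeff_mul, map_sum]
  refine Finset.sum_congr rfl fun p hp => ?_
  by_cases hdeg : p.1.degree ≤ A ∧ p.2.degree ≤ A
  · simp [hdeg]
  · rw [dif_neg hdeg, map_zero]
    rcases not_and_or.1 hdeg with h1 | h2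
    · rw [coeff_eq_zero_of_degree_lt ((hg i).trans_lt (not_le.1 h1)), zero_mul]
    · rw [coeff_eq_zero_of_degree_lt ((hh i).trans_lt (not_le.1 h2)), mul_zero]

/-- **Thinness of the balanced-product class (parameter count).** If
`2 s · C(n + ⌊(2n+2)/3⌋, n) < C(2n - 1, n)` — fewer parameters (coefficients of the `2s`
factors of degree `≤ ⌊(2n+2)/3⌋`) than coordinates of the top component `Sym^n` — then some
NONZERO polynomial in the `N = C(2n,n)` coefficient variables vanishes at `coeff(f)` for every
`f ∈ BP(n, s)`: the class is not Zariski dense, so (non-explicit) equations for it exist.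
[folklore] -/
theorem exists_equation_of_count {n s : ℕ}
    (hcount : 2 * s * (n + (2 * n + 2) / 3).choose n < (2 * n - 1).choose n) :
    ∃ D : MvPolynomial (degLEMonomials n) ℂ, D ≠ 0 ∧
      ∀ f ∈ {f : MvPolynomial (Fin n) ℂ | f.totalDegree ≤ n ∧ ∀ d : ℕ,
          ∃ g h : Fin s → MvPolynomial (Fin n) ℂ,
            (∀ i, (g i).totalDegree ≤ (2 * d + 2) / 3 ∧ (h i).totalDegree ≤ (2 * d + 2) / 3) ∧
            homogeneousComponent d f = ∑ i, g i * h i},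
        eval (coeffVector (degLEMonomials n) f) D = 0 := by
  classical
  set A : ℕ := (2 * n + 2) / 3 with hA
  haveI := finite_degLE n A
  haveI := finite_topMonomials n
  -- the parameter type and the coefficient map
  let τ : Type := Fin s × Bool × {m : Fin n →₀ ℕ // m.degree ≤ A}
  let Φ : topMonomials n → MvPolynomial τ ℂ := fun μ =>
    ∑ i : Fin s, ∑ p ∈ Finset.HasAntidiagonal.antidiagonal (μ : Fin n →₀ ℕ),
      if hp : p.1.degree ≤ A ∧ p.2.degree ≤ A then
        X (i, true, ⟨p.1, hp.1⟩) * X (i, false, ⟨p.2, hp.2⟩) else 0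
  have hτ : Nat.card τ = 2 * s * (n + A).choose n := by
    simp only [τ, Nat.card_prod, Nat.card_eq_fintype_card, Fintype.card_fin, Fintype.card_bool]
    rw [GKSS2017.ncard_degLE, Nat.choose_symm_add]
    ring
  have hlt : Nat.card τ < Nat.card (topMonomials n) := by
    rw [hτ, natCard_topMonomials]; exact hcount
  obtain ⟨P, hP0, hP⟩ := exists_aeval_eq_zero_of_card_lt hlt Φ
  refine ⟨rename (topIncl n) P, ?_, ?_⟩
  · exact fun h0 => hP0 (rename_injective _ (topIncl_injective n) (by rw [h0, map_zero]))
  · rintro f ⟨hfdeg, hf⟩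
    obtain ⟨g, h, hgh, hsum⟩ := hf n
    -- the parameter point
    let pt : τ → ℂ := fun v => if v.2.1 then coeff v.2.2.1 (g v.1) else coeff v.2.2.1 (h v.1)
    have key : ∀ μ : topMonomials n,
        coeffVector (degLEMonomials n) f (topIncl n μ) = eval pt (Φ μ) := by
      intro μ
      have hμ : (μ : Fin n →₀ ℕ).degree = n := μ.2
      rw [coeffVector_apply]
      change coeff (μ : Fin n →₀ ℕ) f = _
      have hc : coeff (μ : Fin n →₀ ℕ) f = coeff (μ : Fin n →₀ ℕ) (homogeneousComponent n f) := by
        rw [coeff_homogeneousComponent, if_pos hμ]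
      rw [hc, hsum]
      have hA' : (2 * n + 2) / 3 = A := rfl
      exact coeff_sum_mul_eq_eval g h (fun i => (hgh i).1) (fun i => (hgh i).2) _
    rw [eval_rename]
    have hfun : (coeffVector (degLEMonomials n) f ∘ topIncl n) = fun μ => eval pt (Φ μ) :=
      funext key
    rw [hfun]
    have h1 : aeval pt (aeval Φ P) = 0 := by rw [hP, map_zero]
    rw [aeval_eq_bind₁ Φ, aeval_bind₁] at h1
    -- `aeval` over the base field is `eval` (`MvPolynomial.aeval_eq_eval`, definitional)
    exact h1

end Thin


/-! ## §6 The count holds for polynomially many terms: equations exist for `BP(n, n^c)` and,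
through §4, for every `SmallCircuits ℂ n b` (a circuit-free re-proof of their existence) -/

section Count

/-- One Pascal step below the middle: `2·C(M, n) ≤ C(M+1, n)` for `1 ≤ n ≤ M ≤ 2n - 2`.
[folklore] -/
theorem two_mul_choose_le_choose_succ {n M : ℕ} (hn : 1 ≤ n) (hM : n ≤ M) (hM2 : M + 2 ≤ 2 * n) :
    2 * M.choose n ≤ (M + 1).choose n := by
  obtain ⟨k, rfl⟩ : ∃ k, n = k + 1 := ⟨n - 1, by omega⟩
  rw [Nat.choose_succ_succ', two_mul]
  refine Nat.add_le_add ?_ le_rfl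
  -- `C(M, k+1) ≤ C(M, k)`: by symmetry `C(M, M-k-1) ≤ C(M, M-k)`, an increasing step left of `M/2`
  have h1 : M.choose (k + 1) = M.choose (M - (k + 1)) := (Nat.choose_symm (by omega)).symm
  have h2 : M.choose k = M.choose (M - k) := (Nat.choose_symm (by omega)).symm
  rw [h1, h2, show M - k = M - (k + 1) + 1 by omega]
  exact Nat.choose_le_succ_of_lt_half_left (by omega)

/-- Iterated: `2^j · C(M, n) ≤ C(M + j, n)` as long as `M + j + 1 ≤ 2n`. [folklore] -/
theorem two_pow_mul_choose_le {n M : ℕ} (hn : 1 ≤ n) (hM : n ≤ M) :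
    ∀ j : ℕ, M + j + 1 ≤ 2 * n → 2 ^ j * M.choose n ≤ (M + j).choose n := by
  intro j
  induction j with
  | zero => intro; simp
  | succ j ih =>
    intro hj
    calc 2 ^ (j + 1) * M.choose n = 2 * (2 ^ j * M.choose n) := by ring
      _ ≤ 2 * (M + j).choose n := Nat.mul_le_mul_left _ (ih (by omega))
      _ ≤ (M + j + 1).choose n := two_mul_choose_le_choose_succ hn (by omega) (by omega)
      _ = (M + (j + 1)).choose n := by rw [Nat.add_assoc]

/-- Polynomial versus exponential: `K · m^c < 2^m` eventually in `m`. [folklore] -/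
theorem eventually_mul_pow_lt_two_pow (c K : ℕ) : ∃ m₀ : ℕ, ∀ m ≥ m₀, K * m ^ c < 2 ^ m := by
  have h := tendsto_pow_const_div_const_pow_of_one_lt c (one_lt_two (α := ℝ))
  have hε : (0 : ℝ) < 1 / ((K : ℝ) + 1) := by positivity
  obtain ⟨m₀, hm₀⟩ := Filter.eventually_atTop.1 (h.eventually (gt_mem_nhds hε))
  refine ⟨m₀, fun m hm => ?_⟩
  have h1 := hm₀ m hm
  rw [lt_div_iff₀ (by positivity), div_mul_eq_mul_div, div_lt_iff₀ (by positivity), one_mul] at h1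
  have h2 : ((K * m ^ c : ℕ) : ℝ) < ((2 ^ m : ℕ) : ℝ) := by
    push_cast
    nlinarith [pow_nonneg (Nat.cast_nonneg (α := ℝ) m) c]
  exact_mod_cast h2

/-- **The count holds eventually for `s ≤ n^c`**: `2 s · C(n + ⌊(2n+2)/3⌋, n) < C(2n-1, n)`
for all large `n` (the ratio is `≥ 2^{(n-5)/3}` by Pascal steps below the middle). [folklore] -/
theorem count_eventually (c : ℕ) : ∃ n₀ : ℕ, ∀ n ≥ n₀, ∀ s ≤ n ^ c,
    2 * s * (n + (2 * n + 2) / 3).choose n < (2 * n - 1).choose n := by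
  obtain ⟨m₀, hm₀⟩ := eventually_mul_pow_lt_two_pow c (2 * 10 ^ c)
  refine ⟨3 * m₀ + 10, fun n hn s hs => ?_⟩
  set A := (2 * n + 2) / 3 with hA
  -- the exponential gap from Pascal steps
  have hiter := two_pow_mul_choose_le (n := n) (M := n + A) (by omega) (by omega) (n - 1 - A)
    (by omega)
  rw [show n + A + (n - 1 - A) = 2 * n - 1 by omega] at hiter
  -- `2 s ≤ 2 n^c < 2^{(n-5)/3} ≤ 2^{n-1-A}`
  set m := (n - 5) / 3 with hm
  have hmm₀ : m₀ ≤ m := by omega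
  have hnm : n ≤ 10 * m := by omega
  have hpow : 2 * n ^ c < 2 ^ (n - 1 - A) := by
    calc 2 * n ^ c ≤ 2 * (10 * m) ^ c := Nat.mul_le_mul_left _ (Nat.pow_le_pow_left hnm c)
      _ = 2 * 10 ^ c * m ^ c := by rw [Nat.mul_pow]; ring
      _ < 2 ^ m := hm₀ m hmm₀
      _ ≤ 2 ^ (n - 1 - A) := Nat.pow_le_pow_right (by norm_num) (by omega)
  have hpos : 0 < (n + A).choose n := Nat.choose_pos (by omega)
  calc 2 * s * (n + A).choose n ≤ 2 * n ^ c * (n + A).choose n :=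
        Nat.mul_le_mul_right _ (Nat.mul_le_mul_left _ hs)
    _ < 2 ^ (n - 1 - A) * (n + A).choose n := Nat.mul_lt_mul_of_pos_right hpow hpos
    _ ≤ (2 * n - 1).choose n := hiter

/-- **Non-explicit equations for bounded balanced strength `n^c`**: for every `c`, eventually in
`n`, some nonzero polynomial in the `N = C(2n,n)` coefficient variables vanishes on `BP(n, s)`
for every `s ≤ n^c`. (What the crux asks for beyond this: EXPLICITNESS — a level-`a` Boolean sum.)
[folklore] -/
theorem exists_equation_eventually (c : ℕ) : ∃ n₀ : ℕ, ∀ n ≥ n₀, ∀ s ≤ n ^ c,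
    ∃ D : MvPolynomial (degLEMonomials n) ℂ, D ≠ 0 ∧
      ∀ f ∈ {f : MvPolynomial (Fin n) ℂ | f.totalDegree ≤ n ∧ ∀ d : ℕ,
          ∃ g h : Fin s → MvPolynomial (Fin n) ℂ,
            (∀ i, (g i).totalDegree ≤ (2 * d + 2) / 3 ∧ (h i).totalDegree ≤ (2 * d + 2) / 3) ∧
            homogeneousComponent d f = ∑ i, g i * h i},
        eval (coeffVector (degLEMonomials n) f) D = 0 := by
  obtain ⟨n₀, hn₀⟩ := count_eventually c
  exact ⟨n₀, fun n hn s hs => exists_equation_of_count (hn₀ n hn s hs)⟩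

end Count

end BalancedStrength

end Summit.ValiantsHypothesis.ValiantsHypothesis.Theorems.BarrierLeverDefinableEquations
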